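import Summits.AnomalousDissipation.AnomalousDissipation.Theorems.SolenoidalFractalHomogenisationLagrangianStepOneLevelSplitDefs
import Summits.AnomalousDissipation.AnomalousDissipation.Theorems.SolenoidalFractalHomogenisationLagrangianStepOneLevelGlueLower
import Literature.Analysis.FluidPDE.PassiveVectorTensorPropagator
import HarnessLib

/-!
# K1L_D · S0′ `stub_windowPropagatorL` DISCHARGED: the two-parameter window propagator along every level partial sum

Proof-support file (all proofs, 0 defs) for the crux `LagrangianRenormalisationStepDesign` (stmt-AnomalousDissipation-27980), v3 cut of
`stub_oneLevelL_IW` (tenure D24-7/D24-8): the S0′ text of planner ad-ideate-p4 g11's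
`Cruxes/LagrangianRenormalisationStep/OneLevelSplitSketch.lean` (`stub_windowPropagatorL`), VERBATIM, proved by instantiating the
Literature propagator `Literature.Analysis.FluidPDE.Torus.exists_isPropagator` (`PassiveVectorTensorPropagator`, p647395) at
`d = Fin 3`, horizon `T = 1`, carrier `E.partialSum m` (jointly continuous under `E.Regular`, hence essentially bounded on `(0,1) × 𝕋³`
by `memLp_top_stLift_of_continuous`; weakly divergence free at every time by `isWeaklyDivFree_partialSum`).

* `windowPropagatorL` — `∀ k E, E.LPermissible → E.Regular → ∀ m 𝔸 lo hi, 0 < lo → NearIso 𝔸 lo hi →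
  ∃ U : ℝ → ℝ → (V2 →L[ℝ] V2), Torus.IsPropagator 1 (E.partialSum m) 𝔸 U` (the S0′ registered-text candidate, byte-for-byte
  the sketch's binder list).
-/

namespace Summit.AnomalousDissipation.AnomalousDissipation.Theorems.SolenoidalFractalHomogenisation.LagrangianStep

open Literature.Analysis Literature.Analysis.FluidPDE Literature.Analysis.FunctionSpaces
open MeasureTheory Set Filter Function
open scoped ENNReal NNReal InnerProductSpace

noncomputable section

/-- **S0′ `stub_windowPropagatorL` (K1L_D v3 cut), PROVED.** For every admissible regular carrier, every level `m` and every
window tensor `NearIso 𝔸 lo hi`, `lo > 0`, the two-parameter solution propagator `U^{m}_{s→t} : V2 →L[ℝ] V2` of the level-`m`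
linear problem (carrier `E.partialSum m`, tensor `𝔸`) on `[0,1]` exists with the seven `IsPropagator` properties (contraction,
cocycle, identity on divergence-free data, divergence-free range, vanishing on the σ-orthogonal complement, weak continuity in
`t`, representation of every weak solution).  Instance of `Torus.exists_isPropagator`. -/
theorem windowPropagatorL : ∀ k (E : LatticeShear.LagrangianLatticeCarrier k), E.LPermissible → E.Regular →
    ∀ (m : ℕ) (𝔸 : Torus.Visc4 (Fin 3)) (lo hi : ℝ), 0 < lo → Torus.NearIso 𝔸 lo hi →
      ∃ U : ℝ → ℝ → (V2 →L[ℝ] V2), Torus.IsPropagator 1 (E.partialSum m) 𝔸 U := by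
  intro k E _hP hR m 𝔸 lo hi hlo h𝔸
  have hc : ∀ i < m, Continuous (uncurry (E.b (i + 1))) := fun i _ => hR.levelRegular.continuous_uncurry_b i
  have hd : ∀ i < m, ∀ t, FunctionSpaces.Torus.IsWeaklyDivFree (E.b (i + 1) t) := fun i _ t => hR.levelRegular.isWeaklyDivFree_b i t
  have hb : MemLp (FunctionSpaces.Torus.stLift (E.partialSum m)) ∞
      (volume.restrict (Ioo 0 1 ×ˢ (univ : Set (EuclideanSpace ℝ (Fin 3))))) :=
    LagrangianRenormalisationStep.memLp_top_stLift_of_continuous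
      (LagrangianRenormalisationStep.continuous_uncurry_partialSum E m hc) 1
  have hbdiv : ∀ᵐ t ∂(volume.restrict (Ioo (0 : ℝ) 1)), FunctionSpaces.Torus.IsWeaklyDivFree (E.partialSum m t) :=
    ae_of_all _ fun t => LagrangianRenormalisationStep.isWeaklyDivFree_partialSum E m hc hd t
  exact Torus.exists_isPropagator h𝔸 hlo hb hbdiv

end

end Summit.AnomalousDissipation.AnomalousDissipation.Theorems.SolenoidalFractalHomogenisation.LagrangianStep
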